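import Summits.QuantumAdvantage.QuantumAdvantage.Theorems.CubicForrelationNearExactIsExactKtThreeTools

/-!
# Crux `CubicForrelation.NearExactIsExact` (stmt-QuantumAdvantage-14043) — Kasami–Tokura for CUBICS below `2d`, III: the structure STEP
  (from the weak weight list on `k` bits to: a cubic on `k + 1` bits with `0 < #E < 2^{k−1}` ones is supported inside an affine hyperplane,
  or `#E = 7·2^{k−4}`)

Certificate seat `b2b-cforr-cert` (gen 19).  HONEST FRAMING: a coding-theory BRICK (standard axioms, no `decide`, uniform in the number of bits);
the induction over `m`, the sharp weight list and the 12- and 14-bit corollaries are in `…KtThreeStructure.lean`.  NOT summit progress.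

THE ARGUMENT (`kt3_structure_step`, for `c` cubic on `m = k + 1` bits with `0 < w = #E < 2^{m−2}`, assuming the weak weight list on `k` bits:
every cubic on `k` bits with `w' < 2^{k−2}` ones has `w' = 0` or `w' = 2^{k−2} − 2^i`, `i ≤ k−3`):
1. Some derivative `Q = c ⊕ c(·⊕a)` has exactly `2^{m−2}` ones (`kt3_exists_rank_two_derivative`).
2. Its support `U = E Δ (E⊕a)` is `{⟨x,z₁⟩ = b₁} ∩ {⟨x,z₂⟩ = b₂}` (`kt3_minweight_quadratic_cells`), and `E ∩ U = E ∖ (E⊕a)` has `e₀ = 2^{m−3}`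
   points (the translation by `a` swaps `E ∩ U` and `U ∖ E`).  Let `e₁, e₂, e₃` count `E` in the other three cells of `(⟨x,z₁⟩, ⟨x,z₂⟩)`.
3. The far sides `{⟨x,z₁⟩ ≠ b₁}`, `{⟨x,z₂⟩ ≠ b₂}`, `{⟨x,z₁⊕z₂⟩ ≠ b₁⊕b₂}` carry `s₁ = e₁+e₃`, `s₂ = e₂+e₃`, `s₃ = e₁+e₂ < 2^{m−3}` points of `E`,
   each the weight of a cubic on `k` bits (`ktg_restrict`), hence `0`, `e₀/2`, or `≥ 3e₀/4` (hypothesis + powers of two).  If some `s_i = 0`,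
   `E` lies in an affine hyperplane.  Otherwise two of them equal `e₀/2 = 2^{m−4}` (as `s₁+s₂+s₃ = 2(w − e₀) < 2e₀`): those sides are
   minimum-weight words of `RM(4,m)` (`c·[affine]`, `te_isDegLeFun_band`), i.e. FLATS, which any further affine hyperplane cuts in `0`, half,
   or all (`ktg2_minweight_twist_sum`); this pins the common cell to `e₀/4` and `w = 7e₀/4 = 7·2^{m−5}` (`kt3_endgame`, linear arithmetic).

References: T. Kasami, N. Tokura, *On the weight structure of Reed–Muller codes*, IEEE Trans. IT 16 (1970) 752–759, Thm 1; F. J. MacWilliams,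
N. J. A. Sloane (1977) Ch. 13 §4, Ch. 15 §3.  The proof is this seat's own elementary argument (the 1970 proof inducts on `f = g ⊕ x_m h`;
Berlekamp–Sloane 1969 use power sums in `GF(2^m)`).  Axioms: the standard three.
-/

set_option linter.dupNamespace false -- D-0017: single-problem summit ⇒ `QuantumAdvantage.QuantumAdvantage` by design

noncomputable section

namespace Summit.QuantumAdvantage.QuantumAdvantage.Theorems.CubicForrelation.NearExactIsExact

open Finset
open Literature.Computability.QuantumComplexity
open Literature.Computability.QuantumComplexity.BuzetChailloux (bxor zeroVec bxor_bxor_cancel_left bxor_zeroVec zeroVec_bxor bxor_comm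
  bxor_self twist_zeroVec_right twist_bxor_right sum_twist_left)
open Literature.Computability.QuantumComplexity.DerivativeWalsh (W twist_bxor_left)
open Literature.Computability.QuantumComplexity.Simon (twist_eq_one_or)
open Summit.QuantumAdvantage.QuantumAdvantage.Theorems.SignedCubicForrelationNotPrBPP (knf_isDegLeFun_ip)

/-! ### The endgame arithmetic -/

/-- **Endgame arithmetic** of the structure step: cell counts `e₀, e₁, e₂, e₃` with `w = e₀+e₁+e₂+e₃ < 2e₀`, the three far sides
`e₁+e₃, e₂+e₃, e₁+e₂` each `0`, `e₀/2` or `≥ 3e₀/4`, and the flat splits of the minimum-weight sides force a vanishing side or `4w = 7e₀`.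
[this work] -/
theorem kt3_endgame (e₀ e₁ e₂ e₃ w : ℕ) (hw : e₀ + e₁ + e₂ + e₃ = w) (hlt : w < 2 * e₀)
    (T₁ : e₁ + e₃ = 0 ∨ 2 * (e₁ + e₃) = e₀ ∨ 3 * e₀ ≤ 4 * (e₁ + e₃))
    (T₂ : e₂ + e₃ = 0 ∨ 2 * (e₂ + e₃) = e₀ ∨ 3 * e₀ ≤ 4 * (e₂ + e₃))
    (T₃ : e₂ + e₁ = 0 ∨ 2 * (e₂ + e₁) = e₀ ∨ 3 * e₀ ≤ 4 * (e₂ + e₁))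
    (F₁ : ¬ 2 * (e₁ + e₃) = e₀ ∨ (e₃ = 0 ∨ 2 * e₃ = e₁ + e₃ ∨ e₃ = e₁ + e₃))
    (F₂ : ¬ 2 * (e₂ + e₃) = e₀ ∨ (e₃ = 0 ∨ 2 * e₃ = e₂ + e₃ ∨ e₃ = e₂ + e₃))
    (F₃ : ¬ 2 * (e₂ + e₁) = e₀ ∨ (e₁ = 0 ∨ 2 * e₁ = e₂ + e₁ ∨ e₁ = e₂ + e₁)) :
    e₁ + e₃ = 0 ∨ e₂ + e₃ = 0 ∨ e₂ + e₁ = 0 ∨ 4 * w = 7 * e₀ := by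
  omega

/-! ### The structure step -/

/-- **Kasami–Tokura for cubics, structure step.**  Assume the weak weight list on `k` bits: every Boolean function of degree `≤ 3` on `k`
bits with `4·#E' < 2^k` ones has `#E' = 0` or `4(#E' + 2^i) = 2^k` with `8·2^i ≤ 2^k`.  Then a Boolean function `c` of degree `≤ 3` on
`k + 1` bits with `0 < #E` and `4·#E < 2^{k+1}` has its support inside an affine hyperplane `{⟨x,z⟩ = b}` (`z ≠ 0`), or `32·#E = 7·2^{k+1}`.
[this work; cite: KasamiTokura1970, Thm 1] -/
theorem kt3_structure_step (k : ℕ)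
    (ih : ∀ c' : (Fin k → Bool) → Bool, IsDegLeFun 3 c' → 4 * #(univ.filter fun y => c' y = true) < 2 ^ k →
      #(univ.filter fun y => c' y = true) = 0 ∨
        ∃ i, 4 * (#(univ.filter fun y => c' y = true) + 2 ^ i) = 2 ^ k ∧ 8 * 2 ^ i ≤ 2 ^ k)
    (c : (Fin (k + 1) → Bool) → Bool) (hc : IsDegLeFun 3 c)
    (hpos : 0 < #(univ.filter fun x => c x = true)) (h4 : 4 * #(univ.filter fun x => c x = true) < 2 ^ (k + 1)) :
    (∃ (z : Fin (k + 1) → Bool) (b : Bool), z ≠ zeroVec ∧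
        ∀ x, c x = true → decide (Odd #(univ.filter fun i => (x i && z i) = true)) = b) ∨
      32 * #(univ.filter fun x => c x = true) = 7 * 2 ^ (k + 1) := by
  classical
  set S := univ.filter (fun x : Fin (k + 1) → Bool => c x = true) with hSdef
  set ℓ : (Fin (k + 1) → Bool) → (Fin (k + 1) → Bool) → Bool :=
    fun z x => decide (Odd #(univ.filter fun i => (x i && z i) = true)) with hℓdef
  have htw : ∀ x z, twist x z = signOf (ℓ z x) := fun x z => vg_twist_eq_signOf x z
  /- 1. a derivative with exactly `2^{m−2}` ones -/
  obtain ⟨a, ha⟩ := kt3_exists_rank_two_derivative c hc hpos h4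
  set Q : (Fin (k + 1) → Bool) → Bool := fun x => c x ^^ c (bxor x a) with hQdef
  have hQ : IsDegLeFun 2 Q := stub_derivDegree (k + 1) 2 c a hc
  have hQper : ∀ x, Q (bxor x a) = Q x := by
    intro x; simp only [Q]; rw [iw_bxor_assoc, BuzetChailloux.bxor_self, bxor_zeroVec, Bool.xor_comm]
  /- 2. its support is the intersection of two affine hyperplanes -/
  obtain ⟨z₁, z₂, b₁, b₂, hz₁, hz₂, h12, hcell⟩ := kt3_minweight_quadratic_cells Q hQ ha
  change ∀ x, Q x = true ↔ (ℓ z₁ x = b₁ ∧ ℓ z₂ x = b₂) at hcell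
  set e : Bool → Bool → ℕ := fun β₁ β₂ => #(univ.filter fun x => c x = true ∧ ℓ z₁ x = β₁ ∧ ℓ z₂ x = β₂) with hedef
  -- `e₀ = e b₁ b₂` is half of `#U`
  have he₀ : 8 * e b₁ b₂ = 2 ^ (k + 1) := by
    have hA : e b₁ b₂ = #(univ.filter fun x => c x = true ∧ Q x = true) := by
      simp only [e]; congr 1; ext x; simp only [mem_filter, mem_univ, true_and, hcell]
    have hB : #(univ.filter fun x => c x = false ∧ Q x = true) = #(univ.filter fun x => c x = true ∧ Q x = true) := by
      refine card_nbij' (fun x => bxor x a) (fun x => bxor x a) (fun x hx => ?_) (fun x hx => ?_)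
        (fun x _ => by simp [iw_bxor_assoc]) (fun x _ => by simp [iw_bxor_assoc])
      · rw [mem_coe, mem_filter] at hx ⊢
        obtain ⟨-, h1, h2⟩ := hx
        refine ⟨mem_univ _, ?_, by rw [hQper]; exact h2⟩
        simp only [Q, h1, Bool.false_xor] at h2; exact h2
      · rw [mem_coe, mem_filter] at hx ⊢
        obtain ⟨-, h1, h2⟩ := hx
        refine ⟨mem_univ _, ?_, by rw [hQper]; exact h2⟩
        simp only [Q, h1, Bool.true_xor] at h2; simpa using h2
    have hU : #(univ.filter fun x => Q x = true) =
        #(univ.filter fun x => c x = true ∧ Q x = true) + #(univ.filter fun x => c x = false ∧ Q x = true) := by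
      rw [← card_filter_add_card_filter_not (s := univ.filter fun x => Q x = true) (fun x => c x = true)]
      congr 1
      · congr 1; ext x; simp only [mem_filter, mem_univ, true_and]
        exact ⟨fun h => ⟨h.2, h.1⟩, fun h => ⟨h.2, h.1⟩⟩
      · congr 1; ext x; simp only [mem_filter, mem_univ, true_and, Bool.not_eq_true]
        exact ⟨fun h => ⟨h.2, h.1⟩, fun h => ⟨h.2, h.1⟩⟩
    rw [hB, ← hA] at hU
    have ha' : 4 * #(univ.filter fun x => Q x = true) = 2 ^ (k + 1) := ha
    omega
  /- cell decompositions of the sides -/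
  have hside₁ : ∀ β₁, #(univ.filter fun x => c x = true ∧ ℓ z₁ x = β₁) = e β₁ b₂ + e β₁ (!b₂) := by
    intro β₁
    rw [← card_filter_add_card_filter_not (s := univ.filter fun x => c x = true ∧ ℓ z₁ x = β₁) (fun x => ℓ z₂ x = b₂)]
    simp only [e, filter_filter]
    congr 1
    · congr 1; ext x; simp only [mem_filter, mem_univ, true_and, and_assoc]
    · congr 1; ext x; simp only [mem_filter, mem_univ, true_and]
      constructor
      · rintro ⟨⟨h1, h2⟩, h3⟩; exact ⟨h1, h2, by revert h3; cases ℓ z₂ x <;> cases b₂ <;> simp⟩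
      · rintro ⟨h1, h2, h3⟩; exact ⟨⟨h1, h2⟩, by rw [h3]; cases b₂ <;> simp⟩
  have hside₂ : ∀ β₂, #(univ.filter fun x => c x = true ∧ ℓ z₂ x = β₂) = e b₁ β₂ + e (!b₁) β₂ := by
    intro β₂
    rw [← card_filter_add_card_filter_not (s := univ.filter fun x => c x = true ∧ ℓ z₂ x = β₂) (fun x => ℓ z₁ x = b₁)]
    simp only [e, filter_filter]
    congr 1
    · congr 1; ext x; simp only [mem_filter, mem_univ, true_and]
      exact ⟨fun h => ⟨h.1.1, h.2, h.1.2⟩, fun h => ⟨⟨h.1, h.2.2⟩, h.2.1⟩⟩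
    · congr 1; ext x; simp only [mem_filter, mem_univ, true_and]
      constructor
      · rintro ⟨⟨h1, h2⟩, h3⟩; exact ⟨h1, by revert h3; cases ℓ z₁ x <;> cases b₁ <;> simp, h2⟩
      · rintro ⟨h1, h2, h3⟩; exact ⟨⟨h1, h3⟩, by rw [h2]; cases b₁ <;> simp⟩
  have hℓ3 : ∀ x, ℓ (bxor z₁ z₂) x = (ℓ z₁ x ^^ ℓ z₂ x) := by
    intro x
    have h := twist_bxor_right x z₁ z₂
    rw [htw, htw, htw] at h
    revert h; cases ℓ (bxor z₁ z₂) x <;> cases ℓ z₁ x <;> cases ℓ z₂ x <;> norm_num [signOf]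
  have hside₃ : #(univ.filter fun x => c x = true ∧ ℓ (bxor z₁ z₂) x = !(b₁ ^^ b₂)) = e b₁ (!b₂) + e (!b₁) b₂ := by
    rw [← card_filter_add_card_filter_not (s := univ.filter fun x => c x = true ∧ ℓ (bxor z₁ z₂) x = !(b₁ ^^ b₂)) (fun x => ℓ z₁ x = b₁)]
    simp only [e, filter_filter]
    congr 1
    · congr 1; ext x; simp only [mem_filter, mem_univ, true_and, hℓ3]
      constructor
      · rintro ⟨⟨h1, h2⟩, h3⟩; exact ⟨h1, h3, by rw [h3] at h2; revert h2; cases ℓ z₂ x <;> cases b₁ <;> cases b₂ <;> simp⟩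
      · rintro ⟨h1, h2, h3⟩; exact ⟨⟨h1, by rw [h2, h3]; cases b₁ <;> cases b₂ <;> simp⟩, h2⟩
    · congr 1; ext x; simp only [mem_filter, mem_univ, true_and, hℓ3]
      constructor
      · rintro ⟨⟨h1, h2⟩, h3⟩
        have h3' : ℓ z₁ x = !b₁ := by revert h3; cases ℓ z₁ x <;> cases b₁ <;> simp
        exact ⟨h1, h3', by rw [h3'] at h2; revert h2; cases ℓ z₂ x <;> cases b₁ <;> cases b₂ <;> simp⟩
      · rintro ⟨h1, h2, h3⟩; exact ⟨⟨h1, by rw [h2, h3]; cases b₁ <;> cases b₂ <;> simp⟩, by rw [h2]; cases b₁ <;> simp⟩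
  have htot : #S = e b₁ b₂ + e b₁ (!b₂) + (e (!b₁) b₂ + e (!b₁) (!b₂)) := by
    rw [← hside₁, ← hside₁, hSdef, ← card_filter_add_card_filter_not (s := univ.filter fun x => c x = true) (fun x => ℓ z₁ x = b₁)]
    simp only [filter_filter]
    congr 2
    ext x; simp only [mem_filter, mem_univ, true_and]
    cases ℓ z₁ x <;> cases b₁ <;> simp
  /- 3. the three far sides are cubic weights on `k` bits -/
  have hrestr : ∀ (z : Fin (k + 1) → Bool) (β : Bool), z ≠ zeroVec →
      4 * #(univ.filter fun x => c x = true ∧ ℓ z x = β) < 2 ^ k →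
      #(univ.filter fun x => c x = true ∧ ℓ z x = β) = 0 ∨
        ∃ i, 4 * (#(univ.filter fun x => c x = true ∧ ℓ z x = β) + 2 ^ i) = 2 ^ k ∧ 8 * 2 ^ i ≤ 2 ^ k := by
    intro z β hz hlt
    obtain ⟨i₀, hi₀⟩ : ∃ i, z i = true := by
      by_contra h
      push Not at h
      exact hz (funext fun i => by simpa [zeroVec] using h i)
    obtain ⟨c', hc', hcard'⟩ := ktg_restrict c hc z i₀ hi₀ β
    have h := ih c' hc' (by rw [hcard']; exact hlt)
    rw [hcard'] at h
    exact h
  have hz3 : bxor z₁ z₂ ≠ zeroVec := by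
    intro h; apply h12; funext i
    have := congrFun h i
    change (z₁ i ^^ z₂ i) = false at this
    revert this; cases z₁ i <;> cases z₂ i <;> simp
  -- powers of two below `e₀/2` are `e₀/2` or `≤ e₀/4`
  have hk2 : 3 ≤ k + 1 := by
    by_contra hcon
    have : 2 ^ (k + 1) ≤ 2 ^ 2 := Nat.pow_le_pow_right (by norm_num) (by omega)
    omega
  obtain ⟨κ, hκ⟩ : ∃ κ, k + 1 = κ + 3 := ⟨k + 1 - 3, by omega⟩
  have he₀κ : e b₁ b₂ = 2 ^ κ := by
    have : 2 ^ (k + 1) = 8 * 2 ^ κ := by rw [hκ, pow_add]; ring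
    omega
  have h2k : 2 ^ k = 4 * 2 ^ κ := by
    have : 2 * 2 ^ k = 2 ^ (k + 1) := by rw [pow_succ]; ring
    omega
  have htri : ∀ s : ℕ, (s = 0 ∨ ∃ i, 4 * (s + 2 ^ i) = 2 ^ k ∧ 8 * 2 ^ i ≤ 2 ^ k) →
      s = 0 ∨ 2 * s = e b₁ b₂ ∨ 3 * e b₁ b₂ ≤ 4 * s := by
    rintro s (h | ⟨i, hi, hi8⟩)
    · exact Or.inl h
    rw [he₀κ]; rw [h2k] at hi hi8
    have hiκ : i + 1 ≤ κ := by
      by_contra hcon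
      have : 2 ^ κ ≤ 2 ^ i := Nat.pow_le_pow_right (by norm_num) (by omega)
      omega
    rcases Nat.eq_or_lt_of_le hiκ with h | h
    · right; left
      have : 2 ^ κ = 2 * 2 ^ i := by rw [← h, pow_succ]; ring
      omega
    · right; right
      have : 4 * 2 ^ i ≤ 2 ^ κ := by
        have := Nat.pow_le_pow_right (show 1 ≤ 2 by norm_num) (show i + 2 ≤ κ by omega)
        rw [pow_add] at this; linarith
      omega
  /- flats: a minimum-weight side is cut evenly by any further affine hyperplane -/
  have hflat : ∀ (z y : Fin (k + 1) → Bool) (β γ : Bool), 16 * #(univ.filter fun x => c x = true ∧ ℓ z x = β) = 2 ^ (k + 1) →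
      #(univ.filter fun x => (c x = true ∧ ℓ z x = β) ∧ ℓ y x = γ) = 0 ∨
      2 * #(univ.filter fun x => (c x = true ∧ ℓ z x = β) ∧ ℓ y x = γ) = #(univ.filter fun x => c x = true ∧ ℓ z x = β) ∨
      #(univ.filter fun x => (c x = true ∧ ℓ z x = β) ∧ ℓ y x = γ) = #(univ.filter fun x => c x = true ∧ ℓ z x = β) := by
    intro z y β γ hcard
    set f : (Fin (k + 1) → Bool) → Bool := fun x => c x && (ℓ z x ^^ !β) with hfdef
    have hf : IsDegLeFun (3 + 1) f := te_isDegLeFun_band hc (tb_isDegLeFun_xor_const (knf_isDegLeFun_ip z) (!β))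
    have hset : (univ.filter fun x => f x = true) = univ.filter fun x => c x = true ∧ ℓ z x = β := by
      apply filter_congr
      intro x _
      simp only [f]
      cases c x <;> cases ℓ z x <;> cases β <;> simp
    have hS' : 2 ^ (3 + 1) * #(univ.filter fun x => f x = true) = 2 ^ (k + 1) := by rw [hset, ← hcard]; ring
    have h := ktg2_minweight_twist_sum f hf hS' y
    have hF := ktg_F_half f y
    rw [hF, hset] at h
    have hsub : (univ.filter fun x => f x = true ∧ ℓ y x = true) = univ.filter fun x => (c x = true ∧ ℓ z x = β) ∧ ℓ y x = true := by
      apply filter_congr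
      intro x _
      simp only [f]
      cases c x <;> cases ℓ z x <;> cases β <;> simp
    change _ - 2 * (#(univ.filter fun x => f x = true ∧ ℓ y x = true) : ℝ) = 0 ∨ _ at h
    rw [hsub] at h
    -- the `γ = true` part, then `γ = false` by complement
    have hsplit : #(univ.filter fun x => (c x = true ∧ ℓ z x = β) ∧ ℓ y x = true) +
        #(univ.filter fun x => (c x = true ∧ ℓ z x = β) ∧ ℓ y x = false) = #(univ.filter fun x => c x = true ∧ ℓ z x = β) := by
      rw [← card_filter_add_card_filter_not (s := univ.filter fun x => c x = true ∧ ℓ z x = β) (fun x => ℓ y x = true)]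
      simp only [filter_filter, Bool.not_eq_true]
    have htrue : #(univ.filter fun x => (c x = true ∧ ℓ z x = β) ∧ ℓ y x = true) = 0 ∨
        2 * #(univ.filter fun x => (c x = true ∧ ℓ z x = β) ∧ ℓ y x = true) = #(univ.filter fun x => c x = true ∧ ℓ z x = β) ∨
        #(univ.filter fun x => (c x = true ∧ ℓ z x = β) ∧ ℓ y x = true) = #(univ.filter fun x => c x = true ∧ ℓ z x = β) := by
      rcases h with h | h | h
      · right; left
        have h' : ((2 * #(univ.filter fun x => (c x = true ∧ ℓ z x = β) ∧ ℓ y x = true) : ℕ) : ℝ) =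
            ((#(univ.filter fun x => c x = true ∧ ℓ z x = β) : ℕ) : ℝ) := by push_cast; linarith
        exact_mod_cast h'
      · left
        have h' : ((#(univ.filter fun x => (c x = true ∧ ℓ z x = β) ∧ ℓ y x = true) : ℕ) : ℝ) = ((0 : ℕ) : ℝ) := by
          push_cast; linarith
        exact_mod_cast h'
      · right; right
        have h' : ((#(univ.filter fun x => (c x = true ∧ ℓ z x = β) ∧ ℓ y x = true) : ℕ) : ℝ) =
            ((#(univ.filter fun x => c x = true ∧ ℓ z x = β) : ℕ) : ℝ) := by linarith
        exact_mod_cast h'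
    cases γ
    · omega
    · exact htrue
  /- the endgame -/
  have h4w : 4 * #S < 8 * e b₁ b₂ := by rw [he₀]; exact h4
  have hfar : 4 * (#S - e b₁ b₂) < 2 ^ k := by omega
  have T₁ := htri _ (hrestr z₁ (!b₁) hz₁ (by rw [hside₁]; omega))
  have T₂ := htri _ (hrestr z₂ (!b₂) hz₂ (by rw [hside₂]; omega))
  have T₃ := htri _ (hrestr (bxor z₁ z₂) (!(b₁ ^^ b₂)) hz3 (by rw [hside₃]; omega))
  rw [hside₁] at T₁; rw [hside₂] at T₂; rw [hside₃] at T₃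
  -- flat splits (only informative when the side has `e₀/2` points)
  have hcellA : ∀ β₁ β₂, #(univ.filter fun x => (c x = true ∧ ℓ z₁ x = β₁) ∧ ℓ z₂ x = β₂) = e β₁ β₂ := by
    intro β₁ β₂; simp only [e]; congr 1; ext x; simp only [mem_filter, mem_univ, true_and, and_assoc]
  have hcellB : ∀ β₁ β₂, #(univ.filter fun x => (c x = true ∧ ℓ z₂ x = β₂) ∧ ℓ z₁ x = β₁) = e β₁ β₂ := by
    intro β₁ β₂; simp only [e]; congr 1; ext x; simp only [mem_filter, mem_univ, true_and]
    exact ⟨fun h => ⟨h.1.1, h.2, h.1.2⟩, fun h => ⟨⟨h.1, h.2.2⟩, h.2.1⟩⟩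
  have hcellC : #(univ.filter fun x => (c x = true ∧ ℓ (bxor z₁ z₂) x = !(b₁ ^^ b₂)) ∧ ℓ z₁ x = !b₁) = e (!b₁) b₂ := by
    simp only [e]; congr 1; ext x; simp only [mem_filter, mem_univ, true_and, hℓ3]
    constructor
    · rintro ⟨⟨h1, h2⟩, h3⟩; exact ⟨h1, h3, by rw [h3] at h2; revert h2; cases ℓ z₂ x <;> cases b₁ <;> cases b₂ <;> simp⟩
    · rintro ⟨h1, h2, h3⟩; exact ⟨⟨h1, by rw [h2, h3]; cases b₁ <;> cases b₂ <;> simp⟩, h2⟩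
  have F₁ : ¬ 2 * (e (!b₁) b₂ + e (!b₁) (!b₂)) = e b₁ b₂ ∨
      (e (!b₁) (!b₂) = 0 ∨ 2 * e (!b₁) (!b₂) = e (!b₁) b₂ + e (!b₁) (!b₂) ∨ e (!b₁) (!b₂) = e (!b₁) b₂ + e (!b₁) (!b₂)) := by
    by_cases hmin : 2 * (e (!b₁) b₂ + e (!b₁) (!b₂)) = e b₁ b₂
    · right
      have h := hflat z₁ z₂ (!b₁) (!b₂) (by rw [hside₁, ← he₀]; omega)
      rw [hcellA, hside₁] at h; exact h
    · exact Or.inl hmin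
  have F₂ : ¬ 2 * (e b₁ (!b₂) + e (!b₁) (!b₂)) = e b₁ b₂ ∨
      (e (!b₁) (!b₂) = 0 ∨ 2 * e (!b₁) (!b₂) = e b₁ (!b₂) + e (!b₁) (!b₂) ∨ e (!b₁) (!b₂) = e b₁ (!b₂) + e (!b₁) (!b₂)) := by
    by_cases hmin : 2 * (e b₁ (!b₂) + e (!b₁) (!b₂)) = e b₁ b₂
    · right
      have h := hflat z₂ z₁ (!b₂) (!b₁) (by rw [hside₂, ← he₀]; omega)
      rw [hcellB, hside₂] at h; exact h
    · exact Or.inl hmin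
  have F₃ : ¬ 2 * (e b₁ (!b₂) + e (!b₁) b₂) = e b₁ b₂ ∨
      (e (!b₁) b₂ = 0 ∨ 2 * e (!b₁) b₂ = e b₁ (!b₂) + e (!b₁) b₂ ∨ e (!b₁) b₂ = e b₁ (!b₂) + e (!b₁) b₂) := by
    by_cases hmin : 2 * (e b₁ (!b₂) + e (!b₁) b₂) = e b₁ b₂
    · right
      have h := hflat (bxor z₁ z₂) z₁ (!(b₁ ^^ b₂)) (!b₁) (by rw [hside₃, ← he₀]; omega)
      rw [hcellC, hside₃] at h; exact h
    · exact Or.inl hmin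
  have hend := kt3_endgame (e b₁ b₂) (e (!b₁) b₂) (e b₁ (!b₂)) (e (!b₁) (!b₂)) #S (by rw [htot]; ring) (by omega)
    T₁ T₂ T₃ F₁ F₂ F₃
  have hbool : ∀ u v : Bool, ¬ u = v → u = !v := by decide
  rcases hend with h | h | h | h
  · left
    refine ⟨z₁, b₁, hz₁, fun x hx => ?_⟩
    by_contra hne
    have hne' : ℓ z₁ x = !b₁ := hbool _ _ hne
    have hmem : x ∈ univ.filter (fun x => c x = true ∧ ℓ z₁ x = !b₁) := mem_filter.2 ⟨mem_univ _, hx, hne'⟩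
    have := card_pos.2 ⟨x, hmem⟩
    rw [hside₁] at this; omega
  · left
    refine ⟨z₂, b₂, hz₂, fun x hx => ?_⟩
    by_contra hne
    have hne' : ℓ z₂ x = !b₂ := hbool _ _ hne
    have hmem : x ∈ univ.filter (fun x => c x = true ∧ ℓ z₂ x = !b₂) := mem_filter.2 ⟨mem_univ _, hx, hne'⟩
    have := card_pos.2 ⟨x, hmem⟩
    rw [hside₂] at this; omega
  · left
    refine ⟨bxor z₁ z₂, b₁ ^^ b₂, hz3, fun x hx => ?_⟩
    by_contra hne
    have hne' : ℓ (bxor z₁ z₂) x = !(b₁ ^^ b₂) := hbool _ _ hne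
    have hmem : x ∈ univ.filter (fun x => c x = true ∧ ℓ (bxor z₁ z₂) x = !(b₁ ^^ b₂)) := mem_filter.2 ⟨mem_univ _, hx, hne'⟩
    have := card_pos.2 ⟨x, hmem⟩
    rw [hside₃] at this; omega
  · right; omega

end Summit.QuantumAdvantage.QuantumAdvantage.Theorems.CubicForrelation.NearExactIsExact

end
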